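import Summits.HodgeConjecture.HodgeCM.Model.ArchKTypeOfSlotChar_1

/-! PORT of `HodgeCM/Model/ArchKTypeOfSlotChar.lean` (HodgeCMPerL run 82) — part 2: continuation of `Summits.HodgeConjecture.HodgeCM.Model.ArchKTypeOfSlotChar_1` (split at a top-level declaration boundary by port_pkg.py; scope re-opened below; declarations unchanged). -/

-- port_pkg: scope re-opened for this part (file-level context, then the namespace/section stack open at the cut)
set_option autoImplicit false
noncomputable section
open Filter Topology Complex
open NumberField NumberField.InfinitePlace NumberField.mixedEmbedding IsDedekindDomain MeasureTheory
open scoped Matrix TensorProduct Classical SchwartzMap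
open MulAction
open Literature.Geometry.ComplexHyperbolic.BallModel (U21 x₀ stabilizerEquivK21)
open Literature.NumberTheory.Automorphic.U21 (K21 matA sclD pPlus pPlus_apply)
open Literature.AlgebraicGeometry.HodgeTheory
open Literature.AlgebraicGeometry.ShimuraVarieties Literature.AlgebraicGeometry.ShimuraVarieties.BallForms
open Literature.NumberTheory.Automorphic Literature.NumberTheory.Weil1964
open Literature.RepresentationTheory.HeisenbergGroup (polar Heisenberg symplecticGroup ofSymplectic)
open Literature.RepresentationTheory.KonnoKonno2007 Literature.RepresentationTheory.KonnoKonno2007.RealDualPair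
open Literature.NumberTheory.GelbartRogawski1991 Literature.NumberTheory.GelbartRogawski1991.UnitaryDualPair
open Literature.Analysis.SegalBargmann Literature.Analysis.Distribution
open Literature.NumberTheory.Automorphic.PicardCM
open HodgeCM.Adelic HodgeCM.PerL34 HodgeCM.Model.HypCensus HodgeCM.Model.SupplyInstance HodgeCM.Model.ArchSideTerm
namespace HodgeCM.Model
section Slot
variable (hHD : exists_isReal_hodgeModel) (hI : hodgePQ_independent_of_hodgeModel)
  (h₁ : BallQuotientUniformised)  (h₃ : CMAbelianVarietyRealised)
variable {L : CMField} {ι₁ : L →+* ℂ} (V : HermSpace3 L ι₁) (c : SeesawCtx L)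
  (hGR : (cmSplittingDatum (L : Type) finProdFinEquiv (frameD V) (frameD_real V) (frameD_ne V) (dW c.D) (dW_real c.D)
    (dW_ne c.D)).CompatibleSplitting)
  (hGR₀ : (cmSplittingDatum (L : Type) (e₁) (frameD V) (frameD_real V) (frameD_ne V) (lineVec (L : Type) (dW c.D 0))
    (fun _ => dW_real c.D 0) (fun _ => dW_ne c.D 0)).CompatibleSplitting)
  (hGR₁ : (cmSplittingDatum (L : Type) (e₁) (frameD V) (frameD_real V) (frameD_ne V) (lineVec (L : Type) (dW c.D 1))
    (fun _ => dW_real c.D 1) (fun _ => dW_ne c.D 1)).CompatibleSplitting)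
  (hGR₂ : (cmSplittingDatum (L : Type) (e₁) (frameD V) (frameD_real V) (frameD_ne V) (lineVec (L : Type) (dW' c.D 0))
    (fun _ => dW'_real c.D 0) (fun _ => dW'_ne c.D 0)).CompatibleSplitting)
  (hGR₃ : (cmSplittingDatum (L : Type) (e₁) (frameD V) (frameD_real V) (frameD_ne V) (lineVec (L : Type) (dW' c.D 1))
    (fun _ => dW'_real c.D 1) (fun _ => dW'_ne c.D 1)).CompatibleSplitting)
  (η₀ η₁ η₂ η₃ : CMAdelic (L : Type) (frameD V) × CMAdelicOne (L : Type) →* ℂˣ)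
  (hmaj : ∀ k : Fin 4, HasThetaMajorants fun (p : ↥(regimeSubgroup L V.Hm) × ↥(NumberField.relNormOneIdeles (↥(maximalRealSubfield L)) L))
      (φ : piSchwartzBruhat (↥(maximalRealSubfield L)) (Fin 3)) => lineRepOf V c.D hGR hGR₀ hGR₁ hGR₂ hGR₃ η₀ η₁ η₂ η₃ k p φ)
  (hrat : ∀ k : Fin 4, ∀ γ ∈ (V.latticeModel printFact_unitaryCompact_holds).Γ,
      ∀ t ∈ NumberField.relNormOneRat (↥(maximalRealSubfield L)) L,
        lineRepOf V c.D hGR hGR₀ hGR₁ hGR₂ hGR₃ η₀ η₁ η₂ η₃ k (γ, t) ∈ thetaStabilizerEnd (↥(maximalRealSubfield L)) (Fin 3))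
  (h₁W : (∀ j, 0 < (ι₁ (dW c.D j)).re) ∨ ∀ j, (ι₁ (dW c.D j)).re < 0)
  (A : ∀ k : Fin 4, ArchLineInput V (lineRepOf V c.D hGR hGR₀ hGR₁ hGR₂ hGR₃ η₀ η₁ η₂ η₃ k))
  (hV : IsAnisotropic L V.Hm) (N : ℕ) (Γ₀ : Level V)
  (hlevel : ∀ δ ∈ levelImage hHD hI h₁ h₃ Γ₀ hV, ∃ x : (V.latticeModel printFact_unitaryCompact_holds).G,
    x ∈ (satLevelRegimeOf V hV Γ₀.K : Subgroup (V.latticeModel printFact_unitaryCompact_holds).G) ∧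
      (archSideOfChar V c hGR hGR₀ hGR₁ hGR₂ hGR₃ η₀ η₁ η₂ η₃ hmaj hrat A).ιinf δ * x ∈ (V.latticeModel printFact_unitaryCompact_holds).Γ)
  (Φ₂ : SchwartzMap ((Fin 3 × {v : {v : InfinitePlace ↥(maximalRealSubfield L) // v.IsReal} // v ≠ cmPlace (L : Type) ι₁}) → ℝ) ℂ)
section One
variable
  (eR : PosIdx (cmXW (L : Type) (frameD V) (lineVec (L : Type) (dW c.D 1)) (fun _ => dW_real c.D 1) ι₁ (cmPlace (L : Type) ι₁)) ≃ Unit)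
  (eS : NegIdx (cmXW (L : Type) (frameD V) (lineVec (L : Type) (dW c.D 1)) (fun _ => dW_real c.D 1) ι₁ (cmPlace (L : Type) ι₁)) ≃ Empty)
  (ℓ₀ : Module.Dual ℂ (Fin 2 → ℂ))
  (arch₀ : blockFamilyOfAt (L : Type) e₁ (frameD V) (frameD_real V) (frameD_ne V) (lineVec (L : Type) (dW c.D 1))
      (fun _ => dW_real c.D 1) (fun _ => dW_ne c.D 1) ι₁ (blockPosEquiv V) (blockNegEquiv V) eR eS (degOnePDual Empty) Φ₂ ℓ₀ =
    (A 1).Φinf)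
  (harch : ∀ a : UnitaryGroup.arch (↥(maximalRealSubfield L)) L (IsCMField.complexConj L) 3 V.Hm,
    UnitaryGroup.archAt (↥(maximalRealSubfield L)) L (IsCMField.complexConj L) 3 V.Hm (UnitaryGroup.cmPlace (L : Type) ι₁)
        (NumberField.complexConj_smul_infinitePlace (L : Type) _) (IsCMField.complexConj_ne_one (L : Type)) a = 1 →
    ∀ ℓ, ((archSideOfChar V c hGR hGR₀ hGR₁ hGR₂ hGR₃ η₀ η₁ η₂ η₃ hmaj hrat A).P 1).ω
        (HodgeCM.Adelic.regimeEquiv L V.Hm hV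
          (UnitaryGroup.archToAdelic (↥(maximalRealSubfield L)) L (IsCMField.complexConj L) 3 V.Hm a), 1)
        (testFun (↥(maximalRealSubfield L)) (Fin 3)
          (blockFamilyOfAt (L : Type) e₁ (frameD V) (frameD_real V) (frameD_ne V) (lineVec (L : Type) (dW c.D 1))
            (fun _ => dW_real c.D 1) (fun _ => dW_ne c.D 1) ι₁ (blockPosEquiv V) (blockNegEquiv V) eR eS (degOnePDual Empty) Φ₂ ℓ)
          (A 1).x₀ N) =
      testFun (↥(maximalRealSubfield L)) (Fin 3)
        (blockFamilyOfAt (L : Type) e₁ (frameD V) (frameD_real V) (frameD_ne V) (lineVec (L : Type) (dW c.D 1))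
          (fun _ => dW_real c.D 1) (fun _ => dW_ne c.D 1) ι₁ (blockPosEquiv V) (blockNegEquiv V) eR eS (degOnePDual Empty) Φ₂ ℓ) (A 1).x₀ N)
  (hfin : ∀ kf : UnitaryGroup.finAdelic (↥(maximalRealSubfield L)) L (IsCMField.complexConj L) 3 V.Hm, kf ∈ Γ₀.K →
    ∀ Φinf : 𝓢((Fin 3 → mixedSpace (↥(maximalRealSubfield L))), ℂ),
      ((archSideOfChar V c hGR hGR₀ hGR₁ hGR₂ hGR₃ η₀ η₁ η₂ η₃ hmaj hrat A).P 1).ω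
          (HodgeCM.Adelic.regimeEquiv L V.Hm hV
            (UnitaryGroup.finAdelicToAdelic (↥(maximalRealSubfield L)) L (IsCMField.complexConj L) 3 V.Hm kf), 1)
          (testFun (↥(maximalRealSubfield L)) (Fin 3) Φinf (A 1).x₀ N) =
        testFun (↥(maximalRealSubfield L)) (Fin 3) Φinf (A 1).x₀ N)
  (hsec : ∀ u : stabilizer U21 x₀,
    cmBlockSectionAt (L : Type) (frameD V) (frameD_real V) (frameD_ne V) (lineVec (L : Type) (dW c.D 1)) (fun _ => dW_real c.D 1)
        (fun _ => dW_ne c.D 1) ι₁ (cmPlace (L : Type) ι₁) (blockPosEquiv V) (blockNegEquiv V) eR eS (u21FrameEquiv (u : U21), 1) =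
      (archSectionFrameOf V u, 1))
  {ev : VacExponents}
  (hK : ∀ (kk : DPK (Fin 2) Unit Unit Empty) (Φ : SchwartzMap (DPIdx (Fin 2) Unit Unit Empty → ℝ) ℂ),
    cmBlockRepAt (L : Type) e₁ (frameD V) (frameD_real V) (frameD_ne V) (lineVec (L : Type) (dW c.D 1)) (fun _ => dW_real c.D 1)
        (fun _ => dW_ne c.D 1) hGR₁ ι₁ (cmPlace (L : Type) ι₁) (blockPosEquiv V) (blockNegEquiv V) eR eS
        (cmBlockSectionAt (L : Type) (frameD V) (frameD_real V) (frameD_ne V) (lineVec (L : Type) (dW c.D 1)) (fun _ => dW_real c.D 1)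
          (fun _ => dW_ne c.D 1) ι₁ (cmPlace (L : Type) ι₁) (blockPosEquiv V) (blockNegEquiv V) eR eS (κ _ _ _ _ kk)) (tensorPi Φ Φ₂) =
      tensorPi (κOp _ _ ev kk Φ) Φ₂)
  (hχ : ∀ u : stabilizer U21 x₀,
    ((lineScalar_one V c.D hGR hGR₀ hGR₁ η₁ (u : U21) : ℂˣ) : ℂ) *
        ((matA (stabilizerEquivK21.symm u)).det ^ ev.eP * sclD (stabilizerEquivK21.symm u) ^ ev.eQ) =
      star (sclD (stabilizerEquivK21.symm u)))
set_option backward.isDefEq.respectTransparency false in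
include h₁W in
/-- **ROW 15 FOR LINE 1 IN THE LITERAL SLOT ALONG `twistU21 ∘ expP` — NO HYPOTHESIS BEYOND THE TERM'S INPUTS** (`hf` = § 4);
the `expP` form is the (TWIST-2) item. -/
theorem isPMinusKilledAlong_archKTypeOfSlotOne_twistG (p : Fin 2) :
    (archKTypeOfSlotOneG hHD hI h₁ h₃ V c hGR hGR₀ hGR₁ hGR₂ hGR₃ η₀ η₁ η₂ η₃ hmaj hrat A hV N Γ₀ hlevel Φ₂ eR eS ℓ₀ arch₀ harch hfin
        hsec hK hχ).IsPMinusKilledAlong (fun b => twistU21 L ι₁ (BallForms.expP b)) (-Complex.I • (Pi.single p 1 : Fin 2 → ℂ)) := by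
  obtain ⟨ω₁, hW₁, hc₁⟩ := exists_isArchWeilDatum_lineSlot (R := Unit) (S := Empty)
  exact ArchKTypeData.isPMinusKilledAlong_of_blockPair
    (X := thetaSpaceInputIn hHD hI h₁ h₃ (archSideOfChar V c hGR hGR₀ hGR₁ hGR₂ hGR₃ η₀ η₁ η₂ η₃ hmaj hrat A) hV) _
    (isArchWeilDatum_cmBlockAt (L : Type) e₁ (frameD V) (frameD_real V) (frameD_ne V) (lineVec (L : Type) (dW c.D 1))
      (fun _ => dW_real c.D 1) (fun _ => dW_ne c.D 1) hGR₁ ι₁ (cmPlace (L : Type) ι₁) (blockPosEquiv V) (blockNegEquiv V) eR eS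
      (frameD_sign_ι₁' V) (line_hs₁W h₁W 1) (frameD_sign_of_ne V) (fun τ hτ => line_hsW (dW c.D 1) τ hτ))
    (continuous_cmBlockRepAt (L : Type) e₁ (frameD V) (frameD_real V) (frameD_ne V) (lineVec (L : Type) (dW c.D 1))
      (fun _ => dW_real c.D 1) (fun _ => dW_ne c.D 1) hGR₁ ι₁ (cmPlace (L : Type) ι₁) (blockPosEquiv V) (blockNegEquiv V) eR eS)
    hW₁ hc₁
    (cmBlockSectionAt (L : Type) (frameD V) (frameD_real V) (frameD_ne V) (lineVec (L : Type) (dW c.D 1)) (fun _ => dW_real c.D 1)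
      (fun _ => dW_ne c.D 1) ι₁ (cmPlace (L : Type) ι₁) (blockPosEquiv V) (blockNegEquiv V) eR eS)
    (continuous_cmBlockSectionAt (L : Type) (frameD V) (frameD_real V) (frameD_ne V) (lineVec (L : Type) (dW c.D 1))
      (fun _ => dW_real c.D 1) (fun _ => dW_ne c.D 1) ι₁ (cmPlace (L : Type) ι₁) (blockPosEquiv V) (blockNegEquiv V) eR eS)
    (coe_cmBlockPhaseHomAt_cmBlockSectionAt (L : Type) e₁ (frameD V) (frameD_real V) (frameD_ne V) (lineVec (L : Type) (dW c.D 1))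
      (fun _ => dW_real c.D 1) (fun _ => dW_ne c.D 1) ι₁ (cmPlace (L : Type) ι₁) (blockPosEquiv V) (blockNegEquiv V) eR eS)
    (fun b => twistU21 L ι₁ (BallForms.expP b))
    ((cmBlockFrameAt (L : Type) e₁ (frameD V) (frameD_real V) (frameD_ne V) (lineVec (L : Type) (dW c.D 1)) (fun _ => dW_real c.D 1)
      (fun _ => dW_ne c.D 1) ι₁ (cmPlace (L : Type) ι₁) (blockPosEquiv V) (blockNegEquiv V) eR eS).symm.toContinuousLinearMap)
    (archKTypeOfSlotOne_hτG hHD hI h₁ h₃ V c hGR hGR₀ hGR₁ hGR₂ hGR₃ η₀ η₁ η₂ η₃ hmaj hrat A hV N Γ₀ hlevel Φ₂ eR eS ℓ₀ arch₀ harch hfin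
      hsec hK hχ)
    Φ₂ (degOnePDual Empty) (fun _ => rfl) (hypOpGen_add_I_smul_rotBoostGen_degOnePDual Empty) p

end One

/-! ### E's binder shape in the literal slot: the `k`-dispatched term for `k = 0 ∨ k = 1` -/

section Dispatch

variable
  (eR₀' : PosIdx (cmXW (L : Type) (frameD V) (lineVec (L : Type) (dW c.D 0)) (fun _ => dW_real c.D 0) ι₁ (cmPlace (L : Type) ι₁)) ≃ Unit)
  (eS₀' : NegIdx (cmXW (L : Type) (frameD V) (lineVec (L : Type) (dW c.D 0)) (fun _ => dW_real c.D 0) ι₁ (cmPlace (L : Type) ι₁)) ≃ Empty)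
  (ℓ₀₀' : Module.Dual ℂ (Fin 2 → ℂ))
  (arch₀₀' : blockFamilyOfAt (L : Type) e₁ (frameD V) (frameD_real V) (frameD_ne V) (lineVec (L : Type) (dW c.D 0))
      (fun _ => dW_real c.D 0) (fun _ => dW_ne c.D 0) ι₁ (blockPosEquiv V) (blockNegEquiv V) eR₀' eS₀' (degOnePDual Empty) Φ₂ ℓ₀₀' =
    (A 0).Φinf)
  (harch₀' : ∀ a : UnitaryGroup.arch (↥(maximalRealSubfield L)) L (IsCMField.complexConj L) 3 V.Hm,
    UnitaryGroup.archAt (↥(maximalRealSubfield L)) L (IsCMField.complexConj L) 3 V.Hm (UnitaryGroup.cmPlace (L : Type) ι₁)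
        (NumberField.complexConj_smul_infinitePlace (L : Type) _) (IsCMField.complexConj_ne_one (L : Type)) a = 1 →
    ∀ ℓ, ((archSideOfChar V c hGR hGR₀ hGR₁ hGR₂ hGR₃ η₀ η₁ η₂ η₃ hmaj hrat A).P 0).ω
        (HodgeCM.Adelic.regimeEquiv L V.Hm hV
          (UnitaryGroup.archToAdelic (↥(maximalRealSubfield L)) L (IsCMField.complexConj L) 3 V.Hm a), 1)
        (testFun (↥(maximalRealSubfield L)) (Fin 3)
          (blockFamilyOfAt (L : Type) e₁ (frameD V) (frameD_real V) (frameD_ne V) (lineVec (L : Type) (dW c.D 0))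
            (fun _ => dW_real c.D 0) (fun _ => dW_ne c.D 0) ι₁ (blockPosEquiv V) (blockNegEquiv V) eR₀' eS₀' (degOnePDual Empty) Φ₂ ℓ)
          (A 0).x₀ N) =
      testFun (↥(maximalRealSubfield L)) (Fin 3)
        (blockFamilyOfAt (L : Type) e₁ (frameD V) (frameD_real V) (frameD_ne V) (lineVec (L : Type) (dW c.D 0))
          (fun _ => dW_real c.D 0) (fun _ => dW_ne c.D 0) ι₁ (blockPosEquiv V) (blockNegEquiv V) eR₀' eS₀' (degOnePDual Empty) Φ₂ ℓ) (A 0).x₀ N)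
  (hfin₀' : ∀ kf : UnitaryGroup.finAdelic (↥(maximalRealSubfield L)) L (IsCMField.complexConj L) 3 V.Hm, kf ∈ Γ₀.K →
    ∀ Φinf : 𝓢((Fin 3 → mixedSpace (↥(maximalRealSubfield L))), ℂ),
      ((archSideOfChar V c hGR hGR₀ hGR₁ hGR₂ hGR₃ η₀ η₁ η₂ η₃ hmaj hrat A).P 0).ω
          (HodgeCM.Adelic.regimeEquiv L V.Hm hV
            (UnitaryGroup.finAdelicToAdelic (↥(maximalRealSubfield L)) L (IsCMField.complexConj L) 3 V.Hm kf), 1)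
          (testFun (↥(maximalRealSubfield L)) (Fin 3) Φinf (A 0).x₀ N) =
        testFun (↥(maximalRealSubfield L)) (Fin 3) Φinf (A 0).x₀ N)
  (hsec₀' : ∀ u : stabilizer U21 x₀,
    cmBlockSectionAt (L : Type) (frameD V) (frameD_real V) (frameD_ne V) (lineVec (L : Type) (dW c.D 0)) (fun _ => dW_real c.D 0)
        (fun _ => dW_ne c.D 0) ι₁ (cmPlace (L : Type) ι₁) (blockPosEquiv V) (blockNegEquiv V) eR₀' eS₀' (u21FrameEquiv (u : U21), 1) =
      (archSectionFrameOf V u, 1))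
  {ev₀' : VacExponents}
  (hK₀' : ∀ (kk : DPK (Fin 2) Unit Unit Empty) (Φ : SchwartzMap (DPIdx (Fin 2) Unit Unit Empty → ℝ) ℂ),
    cmBlockRepAt (L : Type) e₁ (frameD V) (frameD_real V) (frameD_ne V) (lineVec (L : Type) (dW c.D 0)) (fun _ => dW_real c.D 0)
        (fun _ => dW_ne c.D 0) hGR₀ ι₁ (cmPlace (L : Type) ι₁) (blockPosEquiv V) (blockNegEquiv V) eR₀' eS₀'
        (cmBlockSectionAt (L : Type) (frameD V) (frameD_real V) (frameD_ne V) (lineVec (L : Type) (dW c.D 0)) (fun _ => dW_real c.D 0)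
          (fun _ => dW_ne c.D 0) ι₁ (cmPlace (L : Type) ι₁) (blockPosEquiv V) (blockNegEquiv V) eR₀' eS₀' (κ _ _ _ _ kk)) (tensorPi Φ Φ₂) =
      tensorPi (κOp _ _ ev₀' kk Φ) Φ₂)
  (hχ₀' : ∀ u : stabilizer U21 x₀,
    ((lineScalar_zero V c.D hGR hGR₀ hGR₁ η₀ (u : U21) : ℂˣ) : ℂ) *
        ((matA (stabilizerEquivK21.symm u)).det ^ ev₀'.eP * sclD (stabilizerEquivK21.symm u) ^ ev₀'.eQ) =
      star (sclD (stabilizerEquivK21.symm u)))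

variable
  (eR₁' : PosIdx (cmXW (L : Type) (frameD V) (lineVec (L : Type) (dW c.D 1)) (fun _ => dW_real c.D 1) ι₁ (cmPlace (L : Type) ι₁)) ≃ Unit)
  (eS₁' : NegIdx (cmXW (L : Type) (frameD V) (lineVec (L : Type) (dW c.D 1)) (fun _ => dW_real c.D 1) ι₁ (cmPlace (L : Type) ι₁)) ≃ Empty)
  (ℓ₀₁' : Module.Dual ℂ (Fin 2 → ℂ))
  (arch₀₁' : blockFamilyOfAt (L : Type) e₁ (frameD V) (frameD_real V) (frameD_ne V) (lineVec (L : Type) (dW c.D 1))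
      (fun _ => dW_real c.D 1) (fun _ => dW_ne c.D 1) ι₁ (blockPosEquiv V) (blockNegEquiv V) eR₁' eS₁' (degOnePDual Empty) Φ₂ ℓ₀₁' =
    (A 1).Φinf)
  (harch₁' : ∀ a : UnitaryGroup.arch (↥(maximalRealSubfield L)) L (IsCMField.complexConj L) 3 V.Hm,
    UnitaryGroup.archAt (↥(maximalRealSubfield L)) L (IsCMField.complexConj L) 3 V.Hm (UnitaryGroup.cmPlace (L : Type) ι₁)
        (NumberField.complexConj_smul_infinitePlace (L : Type) _) (IsCMField.complexConj_ne_one (L : Type)) a = 1 →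
    ∀ ℓ, ((archSideOfChar V c hGR hGR₀ hGR₁ hGR₂ hGR₃ η₀ η₁ η₂ η₃ hmaj hrat A).P 1).ω
        (HodgeCM.Adelic.regimeEquiv L V.Hm hV
          (UnitaryGroup.archToAdelic (↥(maximalRealSubfield L)) L (IsCMField.complexConj L) 3 V.Hm a), 1)
        (testFun (↥(maximalRealSubfield L)) (Fin 3)
          (blockFamilyOfAt (L : Type) e₁ (frameD V) (frameD_real V) (frameD_ne V) (lineVec (L : Type) (dW c.D 1))
            (fun _ => dW_real c.D 1) (fun _ => dW_ne c.D 1) ι₁ (blockPosEquiv V) (blockNegEquiv V) eR₁' eS₁' (degOnePDual Empty) Φ₂ ℓ)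
          (A 1).x₀ N) =
      testFun (↥(maximalRealSubfield L)) (Fin 3)
        (blockFamilyOfAt (L : Type) e₁ (frameD V) (frameD_real V) (frameD_ne V) (lineVec (L : Type) (dW c.D 1))
          (fun _ => dW_real c.D 1) (fun _ => dW_ne c.D 1) ι₁ (blockPosEquiv V) (blockNegEquiv V) eR₁' eS₁' (degOnePDual Empty) Φ₂ ℓ) (A 1).x₀ N)
  (hfin₁' : ∀ kf : UnitaryGroup.finAdelic (↥(maximalRealSubfield L)) L (IsCMField.complexConj L) 3 V.Hm, kf ∈ Γ₀.K →
    ∀ Φinf : 𝓢((Fin 3 → mixedSpace (↥(maximalRealSubfield L))), ℂ),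
      ((archSideOfChar V c hGR hGR₀ hGR₁ hGR₂ hGR₃ η₀ η₁ η₂ η₃ hmaj hrat A).P 1).ω
          (HodgeCM.Adelic.regimeEquiv L V.Hm hV
            (UnitaryGroup.finAdelicToAdelic (↥(maximalRealSubfield L)) L (IsCMField.complexConj L) 3 V.Hm kf), 1)
          (testFun (↥(maximalRealSubfield L)) (Fin 3) Φinf (A 1).x₀ N) =
        testFun (↥(maximalRealSubfield L)) (Fin 3) Φinf (A 1).x₀ N)
  (hsec₁' : ∀ u : stabilizer U21 x₀,
    cmBlockSectionAt (L : Type) (frameD V) (frameD_real V) (frameD_ne V) (lineVec (L : Type) (dW c.D 1)) (fun _ => dW_real c.D 1)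
        (fun _ => dW_ne c.D 1) ι₁ (cmPlace (L : Type) ι₁) (blockPosEquiv V) (blockNegEquiv V) eR₁' eS₁' (u21FrameEquiv (u : U21), 1) =
      (archSectionFrameOf V u, 1))
  {ev₁' : VacExponents}
  (hK₁' : ∀ (kk : DPK (Fin 2) Unit Unit Empty) (Φ : SchwartzMap (DPIdx (Fin 2) Unit Unit Empty → ℝ) ℂ),
    cmBlockRepAt (L : Type) e₁ (frameD V) (frameD_real V) (frameD_ne V) (lineVec (L : Type) (dW c.D 1)) (fun _ => dW_real c.D 1)
        (fun _ => dW_ne c.D 1) hGR₁ ι₁ (cmPlace (L : Type) ι₁) (blockPosEquiv V) (blockNegEquiv V) eR₁' eS₁'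
        (cmBlockSectionAt (L : Type) (frameD V) (frameD_real V) (frameD_ne V) (lineVec (L : Type) (dW c.D 1)) (fun _ => dW_real c.D 1)
          (fun _ => dW_ne c.D 1) ι₁ (cmPlace (L : Type) ι₁) (blockPosEquiv V) (blockNegEquiv V) eR₁' eS₁' (κ _ _ _ _ kk)) (tensorPi Φ Φ₂) =
      tensorPi (κOp _ _ ev₁' kk Φ) Φ₂)
  (hχ₁' : ∀ u : stabilizer U21 x₀,
    ((lineScalar_one V c.D hGR hGR₀ hGR₁ η₁ (u : U21) : ℂˣ) : ℂ) *
        ((matA (stabilizerEquivK21.symm u)).det ^ ev₁'.eP * sclD (stabilizerEquivK21.symm u) ^ ev₁'.eQ) =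
      star (sclD (stabilizerEquivK21.symm u)))


/-- **E's `C` at the honest S term in the literal slot, `k`-dispatched** (decidable split on `k = 0`, cast on the index). -/
def archKTypeOfSlotG (k : Fin 4) (hk : k = 0 ∨ k = 1) :
    ArchKTypeData (thetaSpaceInputIn hHD hI h₁ h₃ (archSideOfChar V c hGR hGR₀ hGR₁ hGR₂ hGR₃ η₀ η₁ η₂ η₃ hmaj hrat A) hV) k N :=
  if h0 : k = 0 then
    h0.symm ▸ archKTypeOfSlotZeroG hHD hI h₁ h₃ V c hGR hGR₀ hGR₁ hGR₂ hGR₃ η₀ η₁ η₂ η₃ hmaj hrat A hV N Γ₀ hlevel Φ₂ eR₀' eS₀' ℓ₀₀' arch₀₀' harch₀' hfin₀' hsec₀' hK₀' hχ₀'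
  else
    (hk.resolve_left h0).symm ▸ archKTypeOfSlotOneG hHD hI h₁ h₃ V c hGR hGR₀ hGR₁ hGR₂ hGR₃ η₀ η₁ η₂ η₃ hmaj hrat A hV N Γ₀ hlevel Φ₂ eR₁' eS₁' ℓ₀₁' arch₀₁' harch₁' hfin₁' hsec₁' hK₁' hχ₁'

set_option backward.isDefEq.respectTransparency false in
include h₁W in
/-- **ROW 14 for the dispatched slot term — no hypothesis beyond the two lines' inputs.** -/
theorem isWeaklyPDiff_archKTypeOfSlotG (k : Fin 4) (hk : k = 0 ∨ k = 1) :
    (archKTypeOfSlotG hHD hI h₁ h₃ V c hGR hGR₀ hGR₁ hGR₂ hGR₃ η₀ η₁ η₂ η₃ hmaj hrat A hV N Γ₀ hlevel Φ₂ eR₀' eS₀' ℓ₀₀' arch₀₀' harch₀' hfin₀' hsec₀' hK₀' hχ₀' eR₁' eS₁' ℓ₀₁' arch₀₁' harch₁' hfin₁' hsec₁' hK₁' hχ₁' k hk).IsWeaklyPDiff BallForms.expP := by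
  unfold archKTypeOfSlotG
  split
  · next h0 =>
    subst h0
    exact isWeaklyPDiff_archKTypeOfSlotZeroG hHD hI h₁ h₃ V c hGR hGR₀ hGR₁ hGR₂ hGR₃ η₀ η₁ η₂ η₃ hmaj hrat h₁W A hV N Γ₀ hlevel Φ₂ eR₀' eS₀' ℓ₀₀' arch₀₀' harch₀' hfin₀' hsec₀' hK₀' hχ₀'
  · next h0 =>
    obtain rfl : k = 1 := hk.resolve_left h0
    exact isWeaklyPDiff_archKTypeOfSlotOneG hHD hI h₁ h₃ V c hGR hGR₀ hGR₁ hGR₂ hGR₃ η₀ η₁ η₂ η₃ hmaj hrat h₁W A hV N Γ₀ hlevel Φ₂ eR₁' eS₁' ℓ₀₁' arch₀₁' harch₁' hfin₁' hsec₁' hK₁' hχ₁'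

end Dispatch

end Slot

end HodgeCM.Model

end
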